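import Summits.CriticalPhenomena.SAWScalingLimit.Theses.SAWRenewalTightness
import Literature.Probability.RandomPlanarGeometry.SAWRestrictionCovariance
import Literature.Probability.RandomPlanarGeometry.SAWCount
import Literature.Probability.LatticeModels.DiluteLoopModelSAWLaw
import Literature.Probability.LatticeModels.MeshDomainBigComponents
import HarnessLib

/-!
# Crux `ConfinementPositivity` (stmt-CriticalPhenomena-17587), line `Sketch` (card sign-universality),
# stub `stub_slabPairReduction`, part 1: lattice bookkeeping `SlabPair.*`

Helper file for the registered stub `stub_slabPairReduction` (`SlabTubeConfinement → SlabPairConfinement`,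
proved in `…ConfinementPositivitySlabPair.lean`, which imports this file): the comparison of the
partition function `Z_Ω = ∑_γ x_c^{|γ|}` of the critical SAW of a discrete domain `Ω_δ` (sum over
`SAW.DomainSAW Ω δ u v`) with lattice sums over vertex functions `ω ∈ SAW.Zd.sawFun 2 n (v - u)`
(the summands of the slab sums `slabTubeMass` of the line skeleton).

* Walks of `Ω_δ`: supports stay in `Ω_δ` (`support_subset_meshDomain`), lengths are `< #Ω_δ`
  (`length_le_card`), and the VERTEX FUNCTION `i ↦ γ(min i |γ|) - u` (translated to start at `0`,
  frozen after `|γ|` steps) is an element of `Zd.sawFun 2 |γ| (v - u)` (`vertexFn_mem_sawFun`) which,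
  together with `|γ|`, determines `γ` (`ext_vertexFn`, via Mathlib's
  `SimpleGraph.Walk.ext_getVert_le_length`; `sigmaMk_injective`).
* Conversely (`slabPair_exists_domainSAW_of_mem_sawFun`, the registered helper stub of this file),
  for CONVEX `Ω` every `ω ∈ Zd.sawFun 2 n (v - u)` whose
  translated vertices `u + ω i` are mesh vertices of `Ω` is the vertex function of a SAW of `Ω_δ` from
  `u ∈ Ω_δ`: consecutive vertices are mesh edges by convexity, and every vertex lies in the component
  `Ω_δ` of `u` because `ω` itself joins it to `u` one mesh edge at a time
  (`mem_meshDomain_of_reachable_meshVertexGraph`).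
* Partition functions versus lattice sums: `Z` as a finite sum over `DiluteLoopModel.domainSAWFinset`
  (`weight_univ_eq_sum`), and the two comparisons `Z ≤ ∑_{n ≤ N} ∑_{ω ∈ F n} x_c^n`
  (`weight_univ_le_ofReal_sum`) and `∑_{n ≤ N} ∑_{ω ∈ F n} x_c^n ≤ Z` (`ofReal_sum_le_weight_univ`)
  through the injection `γ ↦ (|γ|, vertex function)` into the sigma-set.
* Boxes: mesh vertices of `(0,L) × (-V,V)` (`mem_meshVertices_box`), convexity (`convex_box`), and the
  integer roundings `|δ m| < t ↔ |m| ≤ ⌈t/δ⌉ - 1` (`abs_le_ceil_sub_one`, `abs_mul_lt_of_abs_le`).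

Folklore; no new named fact and no `def` (the vertex function is written out in every statement).
Anchors: `SAW.Zd.mem_sawFun`, `SAW.Zd.walkOfFn` (`Literature/…/SAWCount.lean`),
`DiluteLoopModel.domainSAWFinset` (`Literature/…/DiluteLoopModelSAWLaw.lean`),
`SAW.weight_apply_eq_tsum_indicator` (`Literature/…/SAWRestrictionCovariance.lean`),
`mem_meshDomain_of_reachable_meshVertexGraph` (`Literature/…/MeshDomainBigComponents.lean`).
-/

noncomputable section

open MeasureTheory Set Metric Filter Topology
open scoped ENNReal BigOperators
open Literature.Probability.RandomPlanarGeometry Literature.Probability.LatticeModels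
open Literature.Probability.RandomPlanarGeometry.SAW (criticalFugacity)

namespace Summit.CriticalPhenomena.SAWScalingLimit.Theorems.SlabPair

variable {Ω : Set ℂ} {δ : ℝ} {u v : Site 2}

/-! ### Walks of `Ω_δ`: supports, lengths, vertex functions -/

/-- Every vertex of a walk of `Ω_δ` issued from a vertex of `Ω_δ` lies in `Ω_δ`. [folklore] -/
theorem support_subset_meshDomain {x y : Site 2} (p : (discreteDomainGraph Ω δ).Walk x y)
    (hx : x ∈ meshDomain Ω δ) : ∀ z ∈ p.support, z ∈ meshDomain Ω δ := by
  induction p with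
  | nil => intro z hz; rw [SimpleGraph.Walk.support_nil, List.mem_singleton] at hz; exact hz ▸ hx
  | cons h q ih =>
    intro z hz
    rw [SimpleGraph.Walk.support_cons, List.mem_cons] at hz
    rcases hz with rfl | hz
    · exact hx
    · exact ih (discreteDomainGraph_adj_iff.1 h).2.2 z hz

/-- The `i`-th vertex of a walk of `Ω_δ` issued from a vertex of `Ω_δ` lies in `Ω_δ`. [folklore] -/
theorem getVert_mem_meshDomain {x y : Site 2} (p : (discreteDomainGraph Ω δ).Walk x y)
    (hx : x ∈ meshDomain Ω δ) (i : ℕ) : p.getVert i ∈ meshDomain Ω δ :=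
  support_subset_meshDomain p hx _ (p.getVert_mem_support i)

/-- A SAW of `Ω_δ` from a vertex of `Ω_δ` has fewer steps than `Ω_δ` has vertices. [folklore] -/
theorem length_le_card (γ : SAW.DomainSAW Ω δ u v) (hu : u ∈ meshDomain Ω δ)
    (hfin : (meshDomain Ω δ).Finite) : γ.length + 1 ≤ hfin.toFinset.card := by
  classical
  have hnd : γ.walk.support.Nodup := γ.isPath.support_nodup
  have hlen : γ.walk.support.length = γ.length + 1 := γ.walk.length_support
  rw [← hlen, ← List.toFinset_card_of_nodup hnd]
  refine Finset.card_le_card fun z hz => ?_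
  rw [List.mem_toFinset] at hz
  rw [Set.Finite.mem_toFinset]
  exact support_subset_meshDomain γ.walk hu z hz

/-- The vertex function `i ↦ γ(min i |γ|) - u` of a SAW of `Ω_δ` (translated to start at `0`, frozen
after `|γ|` steps) is an element of `Zd.sawFun`. [folklore] -/
theorem vertexFn_mem_sawFun (γ : SAW.DomainSAW Ω δ u v) :
    (fun i => γ.walk.getVert (min i γ.length) - u) ∈ SAW.Zd.sawFun 2 γ.length (v - u) := by
  rw [SAW.Zd.mem_sawFun]
  have hlen : γ.length = γ.walk.length := rfl
  refine ⟨by simp, fun i hi => ?_, fun i hi => ?_, ?_⟩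
  · simp only [min_eq_right hi]
    show γ.walk.getVert γ.walk.length - u = v - u
    rw [SimpleGraph.Walk.getVert_length]
  · simp only [SAW.Zd.zdGraph_adj_sub_right, min_eq_left hi.le,
      min_eq_left (by omega : i + 1 ≤ γ.length)]
    exact meshGraph_le_zdGraph Ω δ
      (discreteDomainGraph_le_meshGraph Ω δ (γ.walk.adj_getVert_succ (hlen ▸ hi)))
  · intro i hi j hj hij
    simp only [Set.mem_setOf_eq] at hi hj
    simp only [min_eq_left hi, min_eq_left hj] at hij
    exact γ.isPath.getVert_injOn (by simp only [Set.mem_setOf_eq]; omega)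
      (by simp only [Set.mem_setOf_eq]; omega) (sub_left_injective hij)

/-- A SAW of `Ω_δ` is determined by its length and its vertex function
(`SimpleGraph.Walk.ext_getVert_le_length`). [folklore] -/
theorem ext_vertexFn {γ₁ γ₂ : SAW.DomainSAW Ω δ u v} (hl : γ₁.length = γ₂.length)
    (h : (fun i => γ₁.walk.getVert (min i γ₁.length) - u) =
      fun i => γ₂.walk.getVert (min i γ₂.length) - u) : γ₁ = γ₂ := by
  apply SAW.DomainSAW.ext_support
  have h1 : γ₁.walk.length = γ₁.length := rfl
  have hw : γ₁.walk = γ₂.walk := by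
    refine SimpleGraph.Walk.ext_getVert_le_length hl fun k hk => ?_
    rw [h1] at hk
    have := congrFun h k
    simp only [min_eq_left hk, min_eq_left (hl ▸ hk)] at this
    exact sub_left_injective this
  rw [hw]

/-- The map `γ ↦ (|γ|, vertex function of γ)` into the sigma-set is injective. [folklore] -/
theorem sigmaMk_injective :
    Function.Injective fun γ : SAW.DomainSAW Ω δ u v =>
      (⟨γ.length, fun i => γ.walk.getVert (min i γ.length) - u⟩ : Σ _ : ℕ, ℕ → Site 2) := by
  intro γ₁ γ₂ h
  simp only [Sigma.mk.inj_iff, heq_eq_eq] at h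
  exact ext_vertexFn h.1 h.2

end SlabPair

/-! ### From vertex functions to walks of `Ω_δ` (convex `Ω`): the registered helper stub -/

/-- **From a lattice SAW inside a convex domain to a SAW of `Ω_δ`** (registered helper stub
`slabPair_exists_domainSAW_of_mem_sawFun` of stmt-CriticalPhenomena-17587).  If `Ω` is convex,
`u ∈ Ω_δ`, and `ω ∈ Zd.sawFun 2 n (v - u)` has all its translated vertices `u + ω i`, `i ≤ n`, among
the mesh vertices of `Ω`, then there is a SAW `γ` of `Ω_δ` from `u` to `v` of length `n` with vertex
function `ω`: consecutive vertices are mesh edges by convexity, and every vertex lies in the component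
`Ω_δ` of `u` because `ω` itself joins it to `u` one mesh edge at a time. [folklore] -/
theorem slabPair_exists_domainSAW_of_mem_sawFun :
    ∀ {Ω : Set ℂ} {δ : ℝ} {u v : Site 2}, Convex ℝ Ω → u ∈ meshDomain Ω δ →
      ∀ {n : ℕ} {ω : ℕ → Site 2}, ω ∈ SAW.Zd.sawFun 2 n (v - u) →
        (∀ i ≤ n, u + ω i ∈ meshVertices Ω δ) →
        ∃ γ : SAW.DomainSAW Ω δ u v, γ.length = n ∧
          (fun i => γ.walk.getVert (min i γ.length) - u) = ω := by
  intro Ω δ u v hΩ hu n ω hω hvert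
  rw [SAW.Zd.mem_sawFun] at hω
  obtain ⟨h0, hend, hadj, hinj⟩ := hω
  -- mesh adjacency of consecutive translated vertices
  have hadjM : ∀ i < n, (meshGraph Ω δ).Adj (u + ω i) (u + ω (i + 1)) := by
    intro i hi
    rw [meshGraph_adj_iff]
    refine ⟨?_, hΩ.segment_subset (hvert i hi.le) (hvert (i + 1) hi) |>.trans subset_closure⟩
    rw [add_comm u, add_comm u, SAW.Zd.zdGraph_adj_add_right]
    exact hadj i hi
  -- one mesh edge from a vertex of `Ω_δ` stays in `Ω_δ` (a union of whole mesh components)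
  have hstep : ∀ {x y : Site 2}, x ∈ meshDomain Ω δ → y ∈ meshVertices Ω δ →
      (meshGraph Ω δ).Adj x y → y ∈ meshDomain Ω δ := fun {x y} hx hy h =>
    mem_meshDomain_of_reachable_meshVertexGraph hx (meshDomain_subset_meshVertices Ω δ hx) hy
      (SimpleGraph.Adj.reachable (show (meshVertexGraph Ω δ).Adj ⟨x, _⟩ ⟨y, hy⟩ from h))
  -- all translated vertices are in `Ω_δ`
  have hdom : ∀ i ≤ n, u + ω i ∈ meshDomain Ω δ := by
    intro i
    induction i with
    | zero => intro; simpa [h0] using hu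
    | succ i ih =>
      intro hi
      exact hstep (ih (by omega)) (hvert _ hi) (hadjM i (by omega))
  have hadjD : ∀ i < n, (discreteDomainGraph Ω δ).Adj ((fun i => u + ω i) i)
      ((fun i => u + ω i) (i + 1)) := fun i hi =>
    discreteDomainGraph_adj_iff.2 ⟨hadjM i hi, hdom i hi.le, hdom (i + 1) hi⟩
  have hstart : (fun i => u + ω i) 0 = u := by simp [h0]
  have hstop : (fun i => u + ω i) n = v := by
    simp only [hend n le_rfl]
    abel
  set p := (SAW.Zd.walkOfFn (fun i => u + ω i) n hadjD).copy hstart hstop with hp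
  have hplen : p.length = n := by simp [hp]
  have hpget : ∀ i, p.getVert i = u + ω (min i n) := by
    intro i
    simp [hp, SAW.Zd.getVert_walkOfFn]
  have hpath : p.IsPath := by
    rw [← SimpleGraph.Walk.IsPath.getVert_injOn_iff]
    intro i hi j hj hij
    simp only [Set.mem_setOf_eq, hplen] at hi hj
    rw [hpget, hpget, min_eq_left hi, min_eq_left hj] at hij
    exact hinj hi hj (add_left_cancel hij)
  refine ⟨⟨p, hpath⟩, hplen, funext fun i => ?_⟩
  show p.getVert (min i p.length) - u = ω i
  rw [hplen, hpget, min_eq_left (min_le_right i n), add_sub_cancel_left]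
  rcases le_or_gt i n with hi | hi
  · rw [min_eq_left hi]
  · rw [min_eq_right hi.le, hend n le_rfl, hend i hi.le]

namespace SlabPair

variable {Ω : Set ℂ} {δ : ℝ} {u v : Site 2}

/-! ### Partition functions versus lattice sums -/

/-- `Z = ∑_γ x_c^{|γ|}` as a finite sum over `domainSAWFinset`. [folklore] -/
theorem weight_univ_eq_sum (hu : u ∈ meshDomainFinset Ω δ) :
    SAW.weight Ω δ u v Set.univ =
      ∑ γ ∈ DiluteLoopModel.domainSAWFinset (b := v) hu,
        ENNReal.ofReal (criticalFugacity ^ γ.length) := by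
  classical
  rw [SAW.weight_apply_eq_tsum_indicator]
  simp only [Set.indicator_univ]
  exact tsum_eq_sum fun γ hγ => absurd (DiluteLoopModel.mem_domainSAWFinset hu γ) hγ

/-- A double lattice sum `∑_{n ≤ N} ∑_{ω ∈ F n} x_c^n`, cast to `ℝ≥0∞`, is a sum over the sigma-set.
[folklore] -/
theorem ofReal_sum_sum_eq (N : ℕ) (F : ℕ → Finset (ℕ → Site 2)) :
    ENNReal.ofReal (∑ n ∈ Finset.range (N + 1), ∑ _ω ∈ F n, criticalFugacity ^ n) =
      ∑ p ∈ (Finset.range (N + 1)).sigma F, ENNReal.ofReal (criticalFugacity ^ p.1) := by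
  have hx : 0 ≤ criticalFugacity := by
    rw [SAW.criticalFugacity, inv_nonneg, SAW.connectiveConstant]
    exact Real.iInf_nonneg fun n => Real.rpow_nonneg (Nat.cast_nonneg _) _
  rw [ENNReal.ofReal_sum_of_nonneg (fun n _ => Finset.sum_nonneg fun _ _ => pow_nonneg hx _)]
  simp_rw [ENNReal.ofReal_sum_of_nonneg (fun _ _ => pow_nonneg hx _)]
  rw [Finset.sum_sigma]

open Classical in
/-- `Z` as a sum over the IMAGE of `domainSAWFinset` in the sigma-set of (length, vertex function).
[folklore] -/
theorem weight_univ_eq_sum_image (hu : u ∈ meshDomainFinset Ω δ) :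
    SAW.weight Ω δ u v Set.univ =
      ∑ p ∈ (DiluteLoopModel.domainSAWFinset (b := v) hu).image (fun γ : SAW.DomainSAW Ω δ u v =>
          (⟨γ.length, fun i => γ.walk.getVert (min i γ.length) - u⟩ : Σ _ : ℕ, ℕ → Site 2)),
        ENNReal.ofReal (criticalFugacity ^ p.1) := by
  classical
  rw [weight_univ_eq_sum hu, Finset.sum_image fun x _ y _ h => sigmaMk_injective h]

/-- **Upper bound of a partition function by a lattice sum**: if every SAW of `Ω_δ` from `u` to `v`
has length `≤ N` and vertex function in `F |γ|`, then `Z ≤ ∑_{n ≤ N} ∑_{ω ∈ F n} x_c^n`. [folklore] -/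
theorem weight_univ_le_ofReal_sum (hu : u ∈ meshDomainFinset Ω δ) (N : ℕ)
    (F : ℕ → Finset (ℕ → Site 2)) (hN : ∀ γ : SAW.DomainSAW Ω δ u v, γ.length ≤ N)
    (hF : ∀ γ : SAW.DomainSAW Ω δ u v, (fun i => γ.walk.getVert (min i γ.length) - u) ∈ F γ.length) :
    SAW.weight Ω δ u v Set.univ ≤
      ENNReal.ofReal (∑ n ∈ Finset.range (N + 1), ∑ _ω ∈ F n, criticalFugacity ^ n) := by
  classical
  rw [weight_univ_eq_sum_image hu, ofReal_sum_sum_eq]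
  refine Finset.sum_le_sum_of_subset fun p hp => ?_
  rw [Finset.mem_image] at hp
  obtain ⟨γ, -, rfl⟩ := hp
  rw [Finset.mem_sigma]
  exact ⟨Finset.mem_range.2 (Nat.lt_succ_of_le (hN γ)), hF γ⟩

/-- **Lower bound of a partition function by a lattice sum**: if every `ω ∈ F n` is the vertex function
of some SAW of `Ω_δ` from `u` to `v` of length `n`, then `∑_{n ≤ N} ∑_{ω ∈ F n} x_c^n ≤ Z`. [folklore] -/
theorem ofReal_sum_le_weight_univ (hu : u ∈ meshDomainFinset Ω δ) (N : ℕ)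
    (F : ℕ → Finset (ℕ → Site 2))
    (hF : ∀ n, ∀ ω ∈ F n, ∃ γ : SAW.DomainSAW Ω δ u v, γ.length = n ∧
      (fun i => γ.walk.getVert (min i γ.length) - u) = ω) :
    ENNReal.ofReal (∑ n ∈ Finset.range (N + 1), ∑ _ω ∈ F n, criticalFugacity ^ n) ≤
      SAW.weight Ω δ u v Set.univ := by
  classical
  rw [weight_univ_eq_sum_image hu, ofReal_sum_sum_eq]
  refine Finset.sum_le_sum_of_subset fun p hp => ?_
  rw [Finset.mem_sigma] at hp
  obtain ⟨γ, hγn, hγω⟩ := hF p.1 p.2 hp.2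
  rw [Finset.mem_image]
  refine ⟨γ, DiluteLoopModel.mem_domainSAWFinset hu γ, ?_⟩
  rcases p with ⟨n, ω⟩
  simp only at hγn hγω ⊢
  subst hγn
  rw [hγω]

/-! ### Boxes: mesh vertices, convexity, integer rounding -/

/-- Mesh vertices of the open box `(0, L) × (-V, V)`. [folklore] -/
theorem mem_meshVertices_box {L V δ : ℝ} {x : Site 2} :
    x ∈ meshVertices (Set.Ioo (0 : ℝ) L ×ℂ Set.Ioo (-V) V) δ ↔
      (0 < δ * x 0 ∧ δ * x 0 < L) ∧ (-V < δ * x 1 ∧ δ * x 1 < V) := by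
  rw [mem_meshVertices_iff, Complex.mem_reProdIm, meshPoint_re, meshPoint_im, Set.mem_Ioo, Set.mem_Ioo]

/-- Open boxes are convex. [folklore] -/
theorem convex_box (L V : ℝ) : Convex ℝ (Set.Ioo (0 : ℝ) L ×ℂ Set.Ioo (-V) V) := by
  have h : Set.Ioo (0 : ℝ) L ×ℂ Set.Ioo (-V) V =
      ({z : ℂ | 0 < z.re} ∩ {z : ℂ | z.re < L}) ∩ ({z : ℂ | -V < z.im} ∩ {z : ℂ | z.im < V}) := by
    ext z
    simp only [Complex.mem_reProdIm, Set.mem_Ioo, Set.mem_inter_iff, Set.mem_setOf_eq]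
  rw [h]
  exact ((convex_halfSpace_re_gt _).inter (convex_halfSpace_re_lt _)).inter
    ((convex_halfSpace_im_gt _).inter (convex_halfSpace_im_lt _))

/-- `|δ m| < t ⇒ |m| ≤ ⌈t/δ⌉ - 1` for an integer `m` and `δ > 0`. [folklore] -/
theorem abs_le_ceil_sub_one {δ t : ℝ} (hδ : 0 < δ) {m : ℤ} (h : |δ * (m : ℝ)| < t) :
    |m| ≤ ⌈t / δ⌉ - 1 := by
  rw [abs_mul, abs_of_pos hδ] at h
  have h' : (|m| : ℝ) < t / δ := by
    rw [lt_div_iff₀ hδ, mul_comm]; exact_mod_cast h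
  have h'' : |m| < ⌈t / δ⌉ := Int.lt_ceil.2 (by exact_mod_cast h')
  omega

/-- `|m| ≤ ⌈t/δ⌉ - 1 ⇒ |δ m| < t` for an integer `m` and `δ > 0`. [folklore] -/
theorem abs_mul_lt_of_abs_le {δ t : ℝ} (hδ : 0 < δ) {m : ℤ} (h : |m| ≤ ⌈t / δ⌉ - 1) :
    |δ * (m : ℝ)| < t := by
  rw [abs_mul, abs_of_pos hδ]
  have h1 : ((|m| : ℤ) : ℝ) + 1 ≤ (⌈t / δ⌉ : ℝ) := by exact_mod_cast (show |m| + 1 ≤ ⌈t / δ⌉ by omega)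
  have h2 : (⌈t / δ⌉ : ℝ) < t / δ + 1 := Int.ceil_lt_add_one _
  have h3 : (|(m : ℝ)| : ℝ) < t / δ := by
    have : ((|m| : ℤ) : ℝ) = |(m : ℝ)| := Int.cast_abs
    linarith
  rwa [lt_div_iff₀ hδ, mul_comm] at h3

end Summit.CriticalPhenomena.SAWScalingLimit.Theorems.SlabPair

end
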